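/-
Copyright (c) 2026. All rights reserved.
Released under Apache 2.0 license as described in the file LICENSE.
Authors: abc-iut cell, prover seat abc-iut-w4-d095 (wave 4), adapting the reduction of abc-iut-w5-d097
(`LogFrobeniusNotSimCompatOfObstruction.lean`) over the statements of abc-iut-L4-t3 (`LogFrobeniusIncompatibility.lean`).
-/
import Literature.AnabelianGeometry.AbsoluteAnabelian.LogFrobeniusNotSimCompatOfObstruction
import Literature.AnabelianGeometry.AbsoluteAnabelian.LogFrobeniusLogWallArchTSOfObstruction
import HarnessLib

/-!
# [AbsTopIII] Corollary 5.5 (iv), second sentence (`Cor55NotSimultaneouslyCompatible`): the ARCHIMEDEAN cycle on the `TS` side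

S. Mochizuki, *Topics in absolute anabelian geometry III: global reconstruction algorithms*, J. Math. Sci. Univ.
Tokyo 22 (2015) 939–1156 [MochizukiAbsTopIII2015]; locators = pages of the author's manuscript
(`paper:url-5493eb38cbb7`): Cor 5.5 (iv) p. 131 (second sentence: "the telecore structure `𝔗_{An•}` of (ii), the
contact structure `ℋ_{An•}` of (ii), and the observables `S_log`, `S_log⊞` of (iii) are not simultaneously
compatible"), proof pp. 132–133 ("entirely similar to the proofs of assertion (iv) of Corollaries 3.6, 4.5");
Def 5.4 (v) p. 127 (the archimedean graph `k~ →(id) k~ ↠ k^× ↪ k`).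

PROOF-ONLY companion.  abc-iut-w5-d097 reduced the typed second sentence (abc-iut-L4-t3, FACT-LIST F-3190) to the
NONARCHIMEDEAN two-path obstruction (`cor55NotSimultaneouslyCompatible_of_twoPathObstruction`): the telecore and its
contact structure furnish an ISOMORPHISM for the pair `([id₁], [log]·[id₀])` ((A) contact generator pair, (B) the
core homotopy of `An•[𝒳]` restricted to the telecore and post-composed with `φ_□`, (C) the reversed generator pair),
after which the argument is that of the first sentence.  This file runs the same (A)(B)(C) preamble (copied from that
file, credited) followed by the ARCHIMEDEAN CYCLE of `LogFrobeniusLogWallArchTSOfObstruction.lean` on the `TS` side —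
`[id₁]·[λ_sl] ~ [log]·[id₀]·[λ_sl] ~(ι_{ε₁}) [id₁]·[λ_{ν₂}] ~(ι_{ε₂}) [id₁]·[λ_{νₘ}] ~(ι_{ε₃}) [id₁]·[λ_sl]`, homotopy
`= 𝟙` by Def 3.5 (ii) — so that the second sentence, too, follows from an archimedean place with print's pins only:
* `cor55NotSimultaneouslyCompatible_of_cycleObstructionTS` / `…_of_archObstructionTS`;
* `cor55NotSimCompat_of_iotaTS_spaceLink_not_surjective` — the set-theoretic criterion (print's `k^× ↪ k` not
  surjective under a set-valued functor on `𝒩_{v₀}`);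
* `archGenuine_cor55NotSimultaneouslyCompatible_TS` — the second sentence HOLDS at the setting with genuine archimedean
  components (`LogFrobeniusLogWallArchOrigin.lean`) with its `TS`-datum; together with
  `LogFrobeniusLogWallNonarchModel.lean` both print-faithful sentences of Cor 5.5 (iv) now hold at BOTH genuine models.

Refereed pre-IUT material; OUR kernel check of typed statements; nothing here bears on [IUTchIII] Cor. 3.12; no side
taken; typed ≠ proved; model-level ≠ node-level.
-/

set_option autoImplicit false

universe w u

open CategoryTheory Quiver

namespace Literature.AnabelianGeometry.AbsoluteAnabelian

namespace LogFrobeniusSetting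

variable {Vmod : Type u} {isArc : Vmod → Bool} (L : LogFrobeniusSetting Vmod isArc)

/-- Components of heterogeneously equal natural transformations (between propositionally equal functors) are
heterogeneously equal. [folklore] -/
private theorem app_heq_of_heq_natTrans {C : Type (u + 1)} [Category.{u} C] {D : Type (u + 1)} [Category.{u} D]
    {F G F' G' : C ⥤ D} {α : F ⟶ G} {β : F' ⟶ G'} (h : HEq α β) (hF : F = F') (hG : G = G') (x : C) :
    HEq (α.app x) (β.app x) := by
  subst hF hG
  cases h
  rfl

/-- Components of a natural transformation at propositionally equal objects are heterogeneously equal. [folklore] -/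
private theorem app_heq_app {C : Type (u + 1)} [Category.{u} C] {D : Type (u + 1)} [Category.{u} D]
    {F G : C ⥤ D} (α : F ⟶ G) {x y : C} (h : x = y) : HEq (α.app x) (α.app y) := by
  subst h
  rfl

/-- Images under propositionally equal functors of heterogeneously equal morphisms. [folklore] -/
private theorem map_heq_map {C : Type (u + 1)} [Category.{u} C] {D : Type (u + 1)} [Category.{u} D]
    {F G : C ⥤ D} (hFG : F = G) {a b a' b' : C} (ha : a = a') (hb : b = b') {f : a ⟶ b} {g : a' ⟶ b'}
    (h : HEq f g) : HEq (F.map f) (G.map g) := by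
  subst hFG ha hb
  cases h
  rfl

/-- A four-term cycle identity transported along heterogeneous equalities of its terms. [folklore] -/
private theorem eq_id_of_heq_cycle {C : Type (u + 1)} [Category.{u} C] {o₀ o₁ o₂ o₃ c₀ c₁ c₂ c₃ : C}
    (h₀ : o₀ = c₀) (h₁ : o₁ = c₁) (h₂ : o₂ = c₂) (h₃ : o₃ = c₃)
    {κ₁ : o₀ ⟶ o₁} {κ₂ : o₁ ⟶ o₂} {κ₃ : o₂ ⟶ o₃} {κ₄ : o₃ ⟶ o₀}
    {n₁ : c₀ ⟶ c₁} {n₂ : c₁ ⟶ c₂} {n₃ : c₂ ⟶ c₃} {n₄ : c₃ ⟶ c₀}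
    (e₁ : HEq κ₁ n₁) (e₂ : HEq κ₂ n₂) (e₃ : HEq κ₃ n₃) (e₄ : HEq κ₄ n₄)
    (key : ((κ₁ ≫ κ₂) ≫ κ₃) ≫ κ₄ = 𝟙 _) : n₁ ≫ n₂ ≫ n₃ ≫ n₄ = 𝟙 _ := by
  subst h₀ h₁ h₂ h₃
  cases e₁; cases e₂; cases e₃; cases e₄
  simpa only [Category.assoc] using key

/-- Components of a homotopy given by the whiskering axiom of Def 3.5 (ii) (b), read heterogeneously. [folklore] -/
private theorem heq_app_of_eq_whisker {C₁ C₂ C₃ C₄ : Type (u + 1)} [Category.{u} C₁] [Category.{u} C₂]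
    [Category.{u} C₃] [Category.{u} C₄] {F : C₁ ⥤ C₂} {P Q : C₂ ⥤ C₃} {G : C₃ ⥤ C₄} {A B : C₁ ⥤ C₄}
    (η : P ⟶ Q) {θ : A ⟶ B} {E : A = F ⋙ (P ⋙ G)} {E' : F ⋙ (Q ⋙ G) = B}
    (W : θ = eqToHom E ≫ Functor.whiskerLeft F (Functor.whiskerRight η G) ≫ eqToHom E') (x : C₁) :
    HEq (θ.app x) (G.map (η.app (F.obj x))) := by
  subst E E' W
  rw [eqToHom_refl, eqToHom_refl, Category.id_comp, Category.comp_id]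
  rfl

/-- Transport of `IsIso` along a heterogeneous equality of morphisms with propositionally equal endpoints. [folklore] -/
private theorem isIso_of_heq_hom {C : Type*} [Category C] {a b a' b' : C} (ha : a = a') (hb : b = b')
    {f : a ⟶ b} {g : a' ⟶ b'} (h : HEq f g) (hf : IsIso f) : IsIso g := by
  subst ha hb
  cases h
  exact hf

/-- In a family of homotopies, the homotopy of a pair whose swap is also a boundary pair is an isomorphism.
[cite: MochizukiAbsTopIII2015, Definition 3.5 (ii) p.75] -/
private theorem isIso_η_of_mem_swap {V : Type u} [Quiver.{u} V] {D : DiagramOfCategories.{u, u + 1, u} V}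
    (K : D.HomotopyFamily) {a b : V} {p q : Path a b} (h : K.E p q) (h' : K.E q p) : IsIso (K.η h) := by
  refine ⟨K.η h', ?_, ?_⟩
  · rw [← K.η_trans h h', K.η_refl]
  · rw [← K.η_trans h' h, K.η_refl]

/-- **[AbsTopIII] Cor 5.5 (iv), second sentence (`Cor55NotSimultaneouslyCompatible`), REDUCED to the component-level
CYCLE obstruction on the `TS` side at one place** — data and hypothesis EXACTLY as in
`cor55LogWall_of_cycleObstructionTS`: edges `ε₁ : postLog → ν₂`, `ε₂ : ν₂ → νₘ`, `ε₃ : νₘ → spaceLink` of `Γ⃗^log_{v₀}`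
(archimedean: `k~ →(id) k~ ↠ k^× ↪ k`) and "for no isomorphism `a : x₀ ⥲ log(x₀)` is `λ_sl(a) ≫ ι_{ε₁} ≫ ι_{ε₂} ≫ ι_{ε₃}`
the identity".  The telecore `𝔗_{An•}` and its contact structure `ℋ_{An•}` replace the core of the first sentence
(abc-iut-w5-d097's (A)(B)(C)). [cite: MochizukiAbsTopIII2015, Cor 5.5 (iv) p. 131] -/
theorem cor55NotSimultaneouslyCompatible_of_cycleObstructionTS (T : L.TSHomotopies) (v₀ : Vmod)
    (ν₂ νₘ : LogVertex (isArc v₀)) (h₂ : ν₂.isPostLog = false) (hₘ : νₘ.isPostLog = false)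
    (ε₁ : LogEdgeTS (isArc v₀) (LogVertex.postLog (isArc v₀)) ν₂) (ε₂ : LogEdgeTS (isArc v₀) ν₂ νₘ)
    (ε₃ : LogEdgeTS (isArc v₀) νₘ (LogVertex.spaceLink (isArc v₀))) (x₀ : L.X)
    (obstruction : ∀ (a : x₀ ⟶ L.log.obj x₀), IsIso a →
      ∀ (m₁ : (L.lam v₀ (LogVertex.spaceLink (isArc v₀)) ⋙ L.forget v₀).obj (L.log.obj x₀) ⟶
          (L.lam v₀ ν₂ ⋙ L.forget v₀).obj x₀)
        (m₂ : (L.lam v₀ ν₂ ⋙ L.forget v₀).obj x₀ ⟶ (L.lam v₀ νₘ ⋙ L.forget v₀).obj x₀)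
        (m₃ : (L.lam v₀ νₘ ⋙ L.forget v₀).obj x₀ ⟶ (L.lam v₀ (LogVertex.spaceLink (isArc v₀)) ⋙ L.forget v₀).obj x₀),
        HEq m₁ ((T.iota v₀ ε₁).app x₀) → HEq m₂ ((T.iota v₀ ε₂).app x₀) → HEq m₃ ((T.iota v₀ ε₃).app x₀) →
          (L.lam v₀ (LogVertex.spaceLink (isArc v₀)) ⋙ L.forget v₀).map a ≫ m₁ ≫ m₂ ≫ m₃ ≠ 𝟙 _) :
    L.Cor55NotSimultaneouslyCompatible T := by
  rintro ⟨H, hH, hcore, Tl, hJ, -, Hc, Hplus, Hts, K, -, hgen, hobsAll, hJK, hHcK, hcompat⟩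
  obtain ⟨-, hpre, hpost⟩ := (hobsAll v₀).2
  have htsK := (hcompat v₀).2
  have hsl : (LogVertex.spaceLink (isArc v₀)).isPostLog = false := spaceLink_isPostLog _
  have hpl : (LogVertex.postLog (isArc v₀)).isPostLog = true := by
    generalize isArc v₀ = b; cases b <;> rfl
  /- (0) notation (abc-iut-w5-d097): the telecore shape `Γ⃗_{D_{An•}}`, its diagram, a telecore edge `φ_□`, the contact
  generator data -/
  let Sh : ExtShape.{u} (DSub (InFive (isArc := isArc))) := anTelecoreShape Tl.J
  let Dtel := L.anTelecoreDiagram Tl.J Tl.telMap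
  have hJc : Tl.J ⟨.core, core_mem_five⟩ = PUnit.{u + 1} := by
    rw [hJ]; rfl
  obtain ⟨jc⟩ : Nonempty (Tl.J ⟨.core, core_mem_five⟩) := by
    rw [hJc]; exact ⟨PUnit.unit⟩
  obtain ⟨vc, νc', hνc', vr, νr, hνr, hgenBy, -, -, -⟩ := hgen
  let b1 : Sh.Vertex := Sh.base ⟨.row1 (0 + 1), row1_mem_five (0 + 1)⟩
  let b0 : Sh.Vertex := Sh.base ⟨.row1 0, row1_mem_five 0⟩
  let bc : Sh.Vertex := Sh.base ⟨.core, core_mem_five⟩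
  let eId1 : b1 ⟶ bc := show Sh.base ⟨.row1 (0 + 1), row1_mem_five (0 + 1)⟩ ⟶ Sh.base ⟨.core, core_mem_five⟩
    from DEdge.toCore (0 + 1)
  let eLog : b1 ⟶ b0 := show Sh.base ⟨.row1 (0 + 1), row1_mem_five (0 + 1)⟩ ⟶ Sh.base ⟨.row1 0, row1_mem_five 0⟩
    from DEdge.log 0
  let eId0 : b0 ⟶ bc := show Sh.base ⟨.row1 0, row1_mem_five 0⟩ ⟶ Sh.base ⟨.core, core_mem_five⟩
    from DEdge.toCore 0
  let pId1 : Path b1 bc := (Path.nil : Path b1 b1).cons eId1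
  let pLog : Path b1 bc := ((Path.nil : Path b1 b1).cons eLog).cons eId0
  let pDesc : Path bc Sh.obs := descendPath Tl.J vc νc' hνc'
  let pBeta : Path bc bc := betaCorePath Tl.J vc νc' hνc' jc
  /- (1) the telecore/contact homotopy for `([id_1], [id_0]∘[log])`, an isomorphism in `K` (abc-iut-w5-d097's (A)(B)(C)) -/
  have hA : Hc.E (Path.nil : Path bc bc) pBeta :=
    (hgenBy _ _).mpr (Saturation.base (Or.inr (Or.inl ⟨jc, rfl, rfl, Or.inr ⟨HEq.rfl, HEq.rfl⟩⟩)))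
  have hC : Hc.E pBeta (Path.nil : Path bc bc) :=
    (hgenBy _ _).mpr (Saturation.base (Or.inr (Or.inl ⟨jc, rfl, rfl, Or.inl ⟨HEq.rfl, HEq.rfl⟩⟩)))
  obtain ⟨kA, -⟩ := hHcK _ _ hA
  obtain ⟨kC, -⟩ := hHcK _ _ hC
  let X₅ : ExtShape.{u} (DSub (InFive (isArc := isArc))) := obsShape (InFive (isArc := isArc)) DVertex.an
  let c1 : X₅.Vertex := X₅.base ⟨.row1 (0 + 1), row1_mem_five (0 + 1)⟩
  let c0 : X₅.Vertex := X₅.base ⟨.row1 0, row1_mem_five 0⟩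
  let cc : X₅.Vertex := X₅.base ⟨.core, core_mem_five⟩
  let cDesc : Path cc X₅.obs :=
    ((((Path.nil : Path cc cc).cons
      (show X₅.base ⟨.core, core_mem_five⟩ ⟶ X₅.base ⟨.nplus vc, nplus_mem_five vc⟩ from DEdge.lam vc νc' hνc')).cons
      (show X₅.base ⟨.nplus vc, nplus_mem_five vc⟩ ⟶ X₅.base ⟨.nv vc, nv_mem_five vc⟩ from DEdge.forget vc)).cons
      (show X₅.base ⟨.nv vc, nv_mem_five vc⟩ ⟶ X₅.base ⟨.e5, e5_mem_five⟩ from DEdge.toE vc)).cons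
      (show X₅.base ⟨.e5, e5_mem_five⟩ ⟶ X₅.obs from DEdge.κAn)
  let q1 : Path c1 X₅.obs :=
    ((Path.nil : Path c1 c1).cons
      (show X₅.base ⟨.row1 (0 + 1), row1_mem_five (0 + 1)⟩ ⟶ X₅.base ⟨.core, core_mem_five⟩
        from DEdge.toCore (0 + 1))).comp cDesc
  let qL : Path c1 X₅.obs :=
    (((Path.nil : Path c1 c1).cons
      (show X₅.base ⟨.row1 (0 + 1), row1_mem_five (0 + 1)⟩ ⟶ X₅.base ⟨.row1 0, row1_mem_five 0⟩
        from DEdge.log 0)).cons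
      (show X₅.base ⟨.row1 0, row1_mem_five 0⟩ ⟶ X₅.base ⟨.core, core_mem_five⟩ from DEdge.toCore 0)).comp cDesc
  have hB : Tl.Jfam.E (pId1.comp pDesc) (pLog.comp pDesc) := (Tl.restrict_E q1 qL).mp (hcore.boundary_all q1 qL)
  have hB' : Tl.Jfam.E (pLog.comp pDesc) (pId1.comp pDesc) := (Tl.restrict_E qL q1).mp (hcore.boundary_all qL q1)
  have hBφ : Tl.Jfam.E (pId1.comp pBeta) (pLog.comp pBeta) :=
    Tl.Jfam.isSaturated.postcomp hB (phiCorePath Tl.J jc)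
  have hBφ' : Tl.Jfam.E (pLog.comp pBeta) (pId1.comp pBeta) :=
    Tl.Jfam.isSaturated.postcomp hB' (phiCorePath Tl.J jc)
  obtain ⟨kB, -⟩ := hJK _ _ hBφ
  obtain ⟨kB', -⟩ := hJK _ _ hBφ'
  have k₀' : K.E pId1 pLog :=
    K.isSaturated.trans (K.isSaturated.trans (K.isSaturated.precomp kA pId1) kB) (K.isSaturated.precomp kC pLog)
  have k₀'' : K.E pLog pId1 :=
    K.isSaturated.trans (K.isSaturated.trans (K.isSaturated.precomp kA pLog) kB') (K.isSaturated.precomp kC pId1)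
  have hisoK : IsIso (K.η k₀') := isIso_η_of_mem_swap K k₀' k₀''
  /- (2) the three `TS`-pins at `v₀`, transported into `K` -/
  obtain ⟨hm₁, hpin₁⟩ := hpost (LogVertex.postLog (isArc v₀)) ν₂ ε₁ hpl h₂ hsl 0
  obtain ⟨hm₂, hpin₂⟩ := hpre ν₂ νₘ ε₂ h₂ hₘ
  obtain ⟨hm₃, hpin₃⟩ := hpre νₘ (LogVertex.spaceLink (isArc v₀)) ε₃ hₘ hsl
  obtain ⟨t₁, ht₁⟩ := htsK _ _ hm₁
  obtain ⟨t₂, ht₂⟩ := htsK _ _ hm₂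
  obtain ⟨t₃, ht₃⟩ := htsK _ _ hm₃
  let bN : Sh.Vertex := Sh.base ⟨.nv v₀, nv_mem_five v₀⟩
  let lamP : ∀ (ν : LogVertex (isArc v₀)) (hν : ν.isPostLog = false), Path bc bN :=
    fun ν hν => ((Path.nil : Path bc bc).cons
      (show Sh.base ⟨.core, core_mem_five⟩ ⟶ Sh.base ⟨.nplus v₀, nplus_mem_five v₀⟩ from DEdge.lam v₀ ν hν)).cons
      (show Sh.base ⟨.nplus v₀, nplus_mem_five v₀⟩ ⟶ Sh.base ⟨.nv v₀, nv_mem_five v₀⟩ from DEdge.forget v₀)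
  have t₁' : K.E (pLog.comp (lamP _ hsl)) (pId1.comp (lamP ν₂ h₂)) := t₁
  have t₂' : K.E (lamP ν₂ h₂) (lamP νₘ hₘ) := t₂
  have t₃' : K.E (lamP νₘ hₘ) (lamP _ hsl) := t₃
  /- (3) the cycle in `K`; a family assigns the IDENTITY to a pair `(γ, γ)` -/
  have s1 : K.E (pId1.comp (lamP _ hsl)) (pLog.comp (lamP _ hsl)) :=
    K.isSaturated.precomp (K.isSaturated.postcomp k₀' (lamP _ hsl)) Path.nil
  have s2 : K.E (pId1.comp (lamP ν₂ h₂)) (pId1.comp (lamP νₘ hₘ)) :=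
    K.isSaturated.precomp (K.isSaturated.postcomp t₂' Path.nil) pId1
  have s3 : K.E (pId1.comp (lamP νₘ hₘ)) (pId1.comp (lamP _ hsl)) :=
    K.isSaturated.precomp (K.isSaturated.postcomp t₃' Path.nil) pId1
  have key : ((K.η s1 ≫ K.η t₁') ≫ K.η s2) ≫ K.η s3 = 𝟙 _ := by
    rw [← K.η_trans s1 t₁', ← K.η_trans, ← K.η_trans]
    exact K.η_refl _
  have keyx : (((K.η s1).app x₀ ≫ (K.η t₁').app x₀) ≫ (K.η s2).app x₀) ≫ (K.η s3).app x₀ = 𝟙 _ := by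
    have := NatTrans.congr_app key x₀
    simpa only [NatTrans.comp_app, NatTrans.id_app] using this
  /- (4) functor identities along the explicit paths -/
  have E_nil : Dtel.pathFunctor (Path.nil : Path b1 b1) = 𝟭 L.X := DiagramOfCategories.pathFunctor_nil _ _
  have E_id1 : Dtel.pathFunctor pId1 = 𝟭 L.X := by
    simp only [pId1, DiagramOfCategories.pathFunctor_cons, DiagramOfCategories.pathFunctor_nil]; rfl
  have E_log : Dtel.pathFunctor pLog = L.log := by
    simp only [pLog, DiagramOfCategories.pathFunctor_cons, DiagramOfCategories.pathFunctor_nil]; rfl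
  have Q : ∀ (ν : LogVertex (isArc v₀)) (hν : ν.isPostLog = false),
      Dtel.pathFunctor (lamP ν hν) = L.lam v₀ ν ⋙ L.forget v₀ := by
    intro ν hν
    simp only [lamP, DiagramOfCategories.pathFunctor_cons, DiagramOfCategories.pathFunctor_nil]; rfl
  have E1c : ∀ (ν : LogVertex (isArc v₀)) (hν : ν.isPostLog = false),
      Dtel.pathFunctor (pId1.comp (lamP ν hν)) = L.lam v₀ ν ⋙ L.forget v₀ := by
    intro ν hν
    simp only [pId1, lamP, Path.comp_cons, Path.comp_nil, DiagramOfCategories.pathFunctor_cons,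
      DiagramOfCategories.pathFunctor_nil]; rfl
  have ELc : ∀ (ν : LogVertex (isArc v₀)) (hν : ν.isPostLog = false),
      Dtel.pathFunctor (pLog.comp (lamP ν hν)) = L.log ⋙ (L.lam v₀ ν ⋙ L.forget v₀) := by
    intro ν hν
    simp only [pLog, lamP, Path.comp_cons, Path.comp_nil, DiagramOfCategories.pathFunctor_cons,
      DiagramOfCategories.pathFunctor_nil]; rfl
  have PTS : ∀ (ν : LogVertex (isArc v₀)) (hν : ν.isPostLog = false),
      (L.logDiagramTS v₀).pathFunctor (lamPathTS v₀ ν hν) = L.lam v₀ ν ⋙ L.forget v₀ := by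
    intro ν hν
    simp only [lamPathTS, lamEdgeTS, forgetEdgeTS, DiagramOfCategories.pathFunctor_cons,
      DiagramOfCategories.pathFunctor_nil]; rfl
  have PTSd : (L.logDiagramTS v₀).pathFunctor (postLogDomPathTS v₀ 0 hsl) =
      L.log ⋙ (L.lam v₀ (LogVertex.spaceLink (isArc v₀)) ⋙ L.forget v₀) := by
    simp only [postLogDomPathTS, logEdgeTS, toCoreEdgeTS, lamEdgeTS, forgetEdgeTS,
      DiagramOfCategories.pathFunctor_cons, DiagramOfCategories.pathFunctor_nil]; rfl
  have PTSc : (L.logDiagramTS v₀).pathFunctor (postLogCodPathTS v₀ 0 ν₂ h₂) = L.lam v₀ ν₂ ⋙ L.forget v₀ := by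
    simp only [postLogCodPathTS, toCoreEdgeTS, lamEdgeTS, forgetEdgeTS, DiagramOfCategories.pathFunctor_cons,
      DiagramOfCategories.pathFunctor_nil]; rfl
  /- (5) the four factors, heterogeneously -/
  have ht₁' : HEq ((Hts v₀).η hm₁) (K.η t₁') := ht₁
  have ht₂' : HEq ((Hts v₀).η hm₂) (K.η t₂') := ht₂
  have ht₃' : HEq ((Hts v₀).η hm₃) (K.η t₃') := ht₃
  have g₁ : HEq ((K.η t₁').app x₀) ((T.iota v₀ ε₁).app x₀) := by
    obtain ⟨o, o', H⟩ := hpin₁ x₀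
    exact (app_heq_of_heq_natTrans ht₁' (PTSd.trans (ELc _ hsl).symm) (PTSc.trans (E1c ν₂ h₂).symm) x₀).symm.trans
      ((conj_eqToHom_iff_heq' _ _ o o').mp H)
  have g₂ : ∀ y : L.X, HEq ((K.η t₂').app y) ((T.iota v₀ ε₂).app y) := fun y => by
    obtain ⟨o, o', H⟩ := hpin₂ y
    exact (app_heq_of_heq_natTrans ht₂' ((PTS ν₂ h₂).trans (Q ν₂ h₂).symm) ((PTS νₘ hₘ).trans (Q νₘ hₘ).symm) y).symm.trans
      ((conj_eqToHom_iff_heq' _ _ o o').mp H)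
  have g₃ : ∀ y : L.X, HEq ((K.η t₃').app y) ((T.iota v₀ ε₃).app y) := fun y => by
    obtain ⟨o, o', H⟩ := hpin₃ y
    exact (app_heq_of_heq_natTrans ht₃' ((PTS νₘ hₘ).trans (Q νₘ hₘ).symm) ((PTS _ hsl).trans (Q _ hsl).symm) y).symm.trans
      ((conj_eqToHom_iff_heq' _ _ o o').mp H)
  have hx_nil : (Dtel.pathFunctor (Path.nil : Path b1 b1)).obj x₀ = x₀ := Functor.congr_obj E_nil x₀
  have hx_id1 : (Dtel.pathFunctor pId1).obj x₀ = x₀ := Functor.congr_obj E_id1 x₀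
  have hx_log : (Dtel.pathFunctor pLog).obj x₀ = L.log.obj x₀ := Functor.congr_obj E_log x₀
  haveI := hisoK
  obtain ⟨a, ha⟩ : ∃ a : x₀ ⟶ L.log.obj x₀, a = eqToHom hx_id1.symm ≫ (K.η k₀').app x₀ ≫ eqToHom hx_log :=
    ⟨_, rfl⟩
  have ha_iso : IsIso a :=
    isIso_of_heq_hom hx_id1 hx_log ((conj_eqToHom_iff_heq' _ _ hx_id1.symm hx_log).mp ha).symm inferInstance
  have ha_heq : HEq ((K.η k₀').app ((Dtel.pathFunctor (Path.nil : Path b1 b1)).obj x₀)) a :=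
    (app_heq_app (K.η k₀') hx_nil).trans ((conj_eqToHom_iff_heq' _ _ hx_id1.symm hx_log).mp ha).symm
  have E_nilN : Dtel.pathFunctor (Path.nil : Path bN bN) = 𝟭 _ := DiagramOfCategories.pathFunctor_nil _ _
  have e1 : HEq ((K.η s1).app x₀) ((L.lam v₀ (LogVertex.spaceLink (isArc v₀)) ⋙ L.forget v₀).map a) :=
    (heq_app_of_eq_whisker (K.η k₀') (K.η_whisker k₀' Path.nil (lamP _ hsl)) x₀).trans
      (map_heq_map (Q _ hsl) ((Functor.congr_obj E_id1 _).trans hx_nil)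
        ((Functor.congr_obj E_log _).trans (congrArg L.log.obj hx_nil)) ha_heq)
  have e2 : HEq ((K.η s2).app x₀) ((T.iota v₀ ε₂).app x₀) :=
    (heq_app_of_eq_whisker (K.η t₂') (K.η_whisker t₂' pId1 Path.nil) x₀).trans
      (map_heq_map E_nilN (by rw [Functor.congr_obj (Q ν₂ h₂), hx_id1, h₂]; rfl)
        (by rw [Functor.congr_obj (Q νₘ hₘ), hx_id1]) ((app_heq_app (K.η t₂') hx_id1).trans (g₂ _)))
  have e3 : HEq ((K.η s3).app x₀) ((T.iota v₀ ε₃).app x₀) :=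
    (heq_app_of_eq_whisker (K.η t₃') (K.η_whisker t₃' pId1 Path.nil) x₀).trans
      (map_heq_map E_nilN (by rw [Functor.congr_obj (Q νₘ hₘ), hx_id1, hₘ]; rfl)
        (by rw [Functor.congr_obj (Q _ hsl), hx_id1]) ((app_heq_app (K.η t₃') hx_id1).trans (g₃ _)))
  /- (6) "writing out explicitly the meaning" of `ζ = id` at `x₀` -/
  have h₀ : (Dtel.pathFunctor (pId1.comp (lamP _ hsl))).obj x₀ =
      (L.lam v₀ (LogVertex.spaceLink (isArc v₀)) ⋙ L.forget v₀).obj x₀ := Functor.congr_obj (E1c _ hsl) x₀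
  have h₁ : (Dtel.pathFunctor (pLog.comp (lamP _ hsl))).obj x₀ =
      (L.lam v₀ (LogVertex.spaceLink (isArc v₀)) ⋙ L.forget v₀).obj (L.log.obj x₀) :=
    Functor.congr_obj (ELc _ hsl) x₀
  have h₂' : (Dtel.pathFunctor (pId1.comp (lamP ν₂ h₂))).obj x₀ = (L.lam v₀ ν₂ ⋙ L.forget v₀).obj x₀ :=
    Functor.congr_obj (E1c ν₂ h₂) x₀
  have h₃' : (Dtel.pathFunctor (pId1.comp (lamP νₘ hₘ))).obj x₀ = (L.lam v₀ νₘ ⋙ L.forget v₀).obj x₀ :=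
    Functor.congr_obj (E1c νₘ hₘ) x₀
  obtain ⟨m₁, hm₁⟩ : ∃ m₁ : (L.lam v₀ (LogVertex.spaceLink (isArc v₀)) ⋙ L.forget v₀).obj (L.log.obj x₀) ⟶
      (L.lam v₀ ν₂ ⋙ L.forget v₀).obj x₀, m₁ = eqToHom h₁.symm ≫ (K.η t₁').app x₀ ≫ eqToHom h₂' := ⟨_, rfl⟩
  obtain ⟨m₂, hm₂⟩ : ∃ m₂ : (L.lam v₀ ν₂ ⋙ L.forget v₀).obj x₀ ⟶ (L.lam v₀ νₘ ⋙ L.forget v₀).obj x₀,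
      m₂ = eqToHom h₂'.symm ≫ (K.η s2).app x₀ ≫ eqToHom h₃' := ⟨_, rfl⟩
  obtain ⟨m₃, hm₃⟩ : ∃ m₃ : (L.lam v₀ νₘ ⋙ L.forget v₀).obj x₀ ⟶
      (L.lam v₀ (LogVertex.spaceLink (isArc v₀)) ⋙ L.forget v₀).obj x₀,
      m₃ = eqToHom h₃'.symm ≫ (K.η s3).app x₀ ≫ eqToHom h₀ := ⟨_, rfl⟩
  have c₁ : HEq ((K.η t₁').app x₀) m₁ := ((conj_eqToHom_iff_heq' _ _ h₁.symm h₂').mp hm₁).symm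
  have c₂ : HEq ((K.η s2).app x₀) m₂ := ((conj_eqToHom_iff_heq' _ _ h₂'.symm h₃').mp hm₂).symm
  have c₃ : HEq ((K.η s3).app x₀) m₃ := ((conj_eqToHom_iff_heq' _ _ h₃'.symm h₀).mp hm₃).symm
  exact obstruction a ha_iso m₁ m₂ m₃ (c₁.symm.trans g₁) (c₂.symm.trans e2) (c₃.symm.trans e3)
    (eq_id_of_heq_cycle h₀ h₁ h₂' h₃' e1 c₁ c₂ c₃ keyx)

/-- **[AbsTopIII] Cor 5.5 (iv), second sentence, from the ARCHIMEDEAN cycle obstruction on the `TS` side** at one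
archimedean place `v₀`. [cite: MochizukiAbsTopIII2015, Cor 5.5 (iv) p. 131] -/
theorem cor55NotSimultaneouslyCompatible_of_archObstructionTS (T : L.TSHomotopies) (v₀ : Vmod)
    (hv₀ : isArc v₀ = true) (x₀ : L.X)
    (obstruction : ∀ (ν₂ νₘ : LogVertex (isArc v₀)) (_ : ν₂.isPostLog = false) (_ : νₘ.isPostLog = false)
      (ε₁ : LogEdgeTS (isArc v₀) (LogVertex.postLog (isArc v₀)) ν₂) (ε₂ : LogEdgeTS (isArc v₀) ν₂ νₘ)
      (ε₃ : LogEdgeTS (isArc v₀) νₘ (LogVertex.spaceLink (isArc v₀))) (a : x₀ ⟶ L.log.obj x₀), IsIso a →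
      ∀ (m₁ : (L.lam v₀ (LogVertex.spaceLink (isArc v₀)) ⋙ L.forget v₀).obj (L.log.obj x₀) ⟶
          (L.lam v₀ ν₂ ⋙ L.forget v₀).obj x₀)
        (m₂ : (L.lam v₀ ν₂ ⋙ L.forget v₀).obj x₀ ⟶ (L.lam v₀ νₘ ⋙ L.forget v₀).obj x₀)
        (m₃ : (L.lam v₀ νₘ ⋙ L.forget v₀).obj x₀ ⟶ (L.lam v₀ (LogVertex.spaceLink (isArc v₀)) ⋙ L.forget v₀).obj x₀),
        HEq m₁ ((T.iota v₀ ε₁).app x₀) → HEq m₂ ((T.iota v₀ ε₂).app x₀) → HEq m₃ ((T.iota v₀ ε₃).app x₀) →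
          (L.lam v₀ (LogVertex.spaceLink (isArc v₀)) ⋙ L.forget v₀).map a ≫ m₁ ≫ m₂ ≫ m₃ ≠ 𝟙 _) :
    L.Cor55NotSimultaneouslyCompatible T := by
  obtain ⟨ν₂, νₘ, h₂, hₘ, ⟨ε₁⟩, ⟨ε₂⟩, ⟨ε₃⟩⟩ := exists_logCycleTS_of_eq_true (isArc v₀) hv₀
  exact L.cor55NotSimultaneouslyCompatible_of_cycleObstructionTS T v₀ ν₂ νₘ h₂ hₘ ε₁ ε₂ ε₃ x₀
    (obstruction ν₂ νₘ h₂ hₘ ε₁ ε₂ ε₃)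

/-- **[AbsTopIII] Cor 5.5 (iv), second sentence, from the non-surjectivity of print's `k^× ↪ k` on the `TS` side**
(same criterion as `cor55LogWall_of_iotaTS_spaceLink_not_surjective`). [cite: MochizukiAbsTopIII2015, Cor 5.5 (iv) p. 131] -/
theorem cor55NotSimCompat_of_iotaTS_spaceLink_not_surjective (T : L.TSHomotopies) (v₀ : Vmod)
    (hv₀ : isArc v₀ = true) (x₀ : L.X) (Φ : L.N v₀ ⥤ Type w)
    (hΦ : ∀ (ν : LogVertex (isArc v₀)), ν.isPostLog = false →
      ∀ ε : LogEdgeTS (isArc v₀) ν (LogVertex.spaceLink (isArc v₀)),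
        ¬ Function.Surjective (Φ.map ((T.iota v₀ ε).app x₀) : _ → _)) :
    L.Cor55NotSimultaneouslyCompatible T := by
  refine L.cor55NotSimultaneouslyCompatible_of_archObstructionTS T v₀ hv₀ x₀ ?_
  intro ν₂ νₘ _ hₘ ε₁ ε₂ ε₃ a _ m₁ m₂ m₃ _ _ hm₃ hcomp
  have hobj : (L.lam v₀ νₘ ⋙ L.forget v₀).obj x₀ =
      ((frobeniusTwist L.log νₘ.isPostLog ⋙ L.lam v₀ νₘ) ⋙ L.forget v₀).obj x₀ := by
    rw [hₘ]
    rfl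
  have hm₃' : m₃ = eqToHom hobj ≫ (T.iota v₀ ε₃).app x₀ ≫ eqToHom rfl :=
    (conj_eqToHom_iff_heq' m₃ ((T.iota v₀ ε₃).app x₀) hobj rfl).mpr hm₃
  have hsurj : Function.Surjective (Φ.map m₃ : _ → _) := by
    have h := congrArg Φ.map hcomp
    intro y
    refine ⟨Φ.map m₂ (Φ.map m₁
      (Φ.map ((L.lam v₀ (LogVertex.spaceLink (isArc v₀)) ⋙ L.forget v₀).map a) y)), ?_⟩
    have hy := CategoryTheory.congr_fun h y
    simp only [Functor.map_comp_apply, Functor.map_id_apply] at hy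
    exact hy
  rw [hm₃'] at hsurj
  simp only [eqToHom_refl, Category.comp_id, Functor.map_comp, types_comp] at hsurj
  exact hΦ νₘ hₘ ε₃ (Function.Surjective.of_comp hsurj)

/-- **The second sentence of Cor 5.5 (iv) HOLDS at the setting with genuine archimedean components** (with its
`TS`-datum; print-faithful `TS`-side route: `k^× ↪ k` misses `0`).  With `LogFrobeniusLogWallNonarchModel.lean` both
print-faithful sentences now hold at BOTH genuine models.  MODEL-LEVEL. [cite: MochizukiAbsTopIII2015, Cor 5.5 (iv) p. 131] -/
theorem archGenuine_cor55NotSimultaneouslyCompatible_TS (𝔄 : AutHolFieldFunctor.{u}) (Vmod : Type (u + 1))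
    (isArc : Vmod → Bool) (v₀ : Vmod) (hv₀ : isArc v₀ = true) (x₀ : Up (HolTFPair 𝔄)) :
    (archGenuine 𝔄 Vmod isArc).Cor55NotSimultaneouslyCompatible (archGenuineTS 𝔄 Vmod isArc) :=
  (archGenuine 𝔄 Vmod isArc).cor55NotSimCompat_of_iotaTS_spaceLink_not_surjective (archGenuineTS 𝔄 Vmod isArc)
    v₀ hv₀ x₀ (inducedFunctor _ ⋙ HolTHPair.forget 𝔄)
    (fun ν _ ε => forget_archIotaTS_spaceLink_not_surjective 𝔄 (isArc v₀) hv₀ ν ε x₀)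

end LogFrobeniusSetting

end Literature.AnabelianGeometry.AbsoluteAnabelian
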